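/-
Copyright (c) 2026 the pub-hodgecm-mathlib formalisation cell (harness21).  Prover seat hodgecm-mathlib-K2E3-p25 (g2), HCML Track B «K2-LIT»,
h413 = `stmt-HodgeConjecture-24833`, road (11-3-split-nsc), leaf (nsc-S-A′), brick (E4b-1γ, part 3d = KERNEL of the open-cell map) of the weak cell lemma (dealer D105′).
2026-09-04.
-/
import Summits.HodgeConjecture.HodgeConjecture.Theorems.K2E3GL3BorelInducedJacquetQOpenCellIntegrand   -- ★ parts 1, 2a, 2b
import Summits.HodgeConjecture.HodgeConjecture.Theorems.K2E3GL3BorelInducedJacquetQOpenCellHaar        -- ★ part 3b `exists_avgProj_eq_smul_setIntegral`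
import Summits.HodgeConjecture.HodgeConjecture.Theorems.K2E3GL3BorelInducedJacquetQOpenCellReduction   -- ★ part 3c `exists_borel_mul_eq_cellPoint_glInt`
import Summits.HodgeConjecture.HodgeConjecture.Theorems.K2E3GL3BorelInducedJacquetQFiltration          -- ★ (E4b-1α) `minor_mul_eq_zero_of_mem_parabolic_twoOne`
import Summits.HodgeConjecture.HodgeConjecture.Theorems.K2E3GL3WeakCellLemmaTransport                 -- ★ `exists_eq_trivial_twist`
import Summits.HodgeConjecture.HodgeConjecture.Theorems.K2E3ZeroIntegralCosetAveraging                -- ★ (E4b-τ) `setIntegral_leftAddCoset_eq_zero_of_support_subset`, `mk_restrictUnipotentGL_avgProj`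
import Literature.NumberTheory.Automorphic.JacquetModuleProofs                                       -- ★ `DeltaCharBorel.isOpen_setOf_valuation_le`
import HarnessLib

/-!
# K2_E3 road (h413), leaf (nsc-S-A′), brick E4b-1γ part 3d — THE KERNEL OF THE OPEN-CELL MAP: `∫ f(w·n(v)·ι̂(g)) dv = 0` for all `g` forces `[f] = 0` in `r_P(I)`

Cell `pub/hodgecm-mathlib` (D-0151), Track B, seat K2E3-p25 (g2).  `--supports stmt-HodgeConjecture-24833 --as helper`; THEOREMS ONLY (no `def`, no instance, no notation,
no `sorry`); never imports `Cruxes/…/Lines`.  COUNT-NEUTRAL.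

THE MATHEMATICS ([BernsteinZelevinsky1977, Thm. 5.2 (injectivity on the open orbit)]; [BernsteinZelevinsky1976, 2.33 (Jacquet's lemma)]; [Casselman1995, Prop. 6.3.1, §3.3]).
`f ∈ X_Z` (vanishing on `Z = {m = 0}`) with all cell integrals `∫_{F²} f(w·n(v)·ι̂(g)) dv = 0`.  Let `ε` fix `f` under the lower root elements (★ part 1) and `L = {v ∣ |vᵢ| ≤ ε⁻¹}`,
`K = n(L) ≤ U_P`.  Then `e_K f = 0`: by ★ part 3b `(e_K f)(x) = c·∫_{v∈L} f(x·n(v)) dv`; for `x ∈ Z` the integrand vanishes (`Z·U_P ⊆ Z`); for `x ∉ Z` write `x = b·w·n(v′)·ι̂(k)`,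
`k ∈ GL₂(𝒪)` (★ part 3c), so `f(x n(v)) = χ_{σ′}(b) φ_k(v′ + kv)` with `φ_k = f(w·n(·)·ι̂(k))` supported in `L` (★ part 1: `‖k‖ ≤ 1`) and `kL = L`; the substitution `u = v′ + kv`
(★ Weil, translation) turns the integral into `∫_{v′ + L} φ_k = 0` (★ (τ1): a coset of `L` either misses `supp φ_k ⊆ L` or carries the whole integral `∫ φ_k = 0`).  Hence
`[f] = [e_K f] = 0` (★ `mk_restrictUnipotentGL_avgProj`): **`mk_eq_zero_of_integral_cellFn_eq_zero`**.

HONEST LABEL: HC_CM is proved only modulo the 7 printed citations (2 remaining named inputs: hLiu418 = stmt-HodgeConjecture-24832, h413 = stmt-HodgeConjecture-24833) until rung 0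
closes; count-neutral helper.

## References
* [BernsteinZelevinsky1977] I. N. Bernstein, A. V. Zelevinsky, *Induced representations of reductive p-adic groups I*, Ann. Sci. ÉNS 10 (1977), Thm. 5.2.
* [BernsteinZelevinsky1976] I. N. Bernstein, A. V. Zelevinsky, *Representations of the group GL(n,F)…*, Russian Math. Surveys 31 (1976), 2.33.
* [Casselman1995] W. Casselman, *Introduction to the theory of admissible representations of p-adic reductive groups* (draft 1995), Prop. 6.3.1, §3.3.
-/

set_option autoImplicit false
set_option linter.dupNamespace false

noncomputable section

open Function Representation ValuativeRel MeasureTheory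
open scoped MatrixGroups NNReal Pointwise
open Literature.NumberTheory.Automorphic Literature.NumberTheory.Weil1964 Literature.NumberTheory.GaloisRepresentations.IsNonarchimedeanLocalField
open Summit.HodgeConjecture.HodgeConjecture.Cruxes.H413.K2E3GL3BorelInducedJacquetQOpenCellSupport
open Summit.HodgeConjecture.HodgeConjecture.Cruxes.H413.K2E3GL3BorelInducedJacquetQOpenCellAlgebra
open Summit.HodgeConjecture.HodgeConjecture.Cruxes.H413.K2E3GL3BorelInducedJacquetQOpenCellIntegrand
open Summit.HodgeConjecture.HodgeConjecture.Cruxes.H413.K2E3GL3BorelInducedJacquetQOpenCellHaar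
open Summit.HodgeConjecture.HodgeConjecture.Cruxes.H413.K2E3GL3BorelInducedJacquetQOpenCellReduction
open Summit.HodgeConjecture.HodgeConjecture.Cruxes.H413.K2E3GL3BorelInducedJacquetQFiltration
open Summit.HodgeConjecture.HodgeConjecture.Cruxes.H413.K2E3GL3WeakCellLemmaTransport
open Summit.HodgeConjecture.HodgeConjecture.Cruxes.H413.K2E3ZeroIntegralCosetAveraging

namespace Summit.HodgeConjecture.HodgeConjecture.Cruxes.H413.K2E3GL3BorelInducedJacquetQOpenCellKernel

variable {F : Type} [Field F] [ValuativeRel F] [TopologicalSpace F] [IsNonarchimedeanLocalField F] [MeasurableSpace F] [BorelSpace F]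
  (μ : Measure F) [μ.IsAddHaarMeasure]
  (h02 : (0 : Fin 3) ≠ 2) (h12 : (1 : Fin 3) ≠ 2)
  (σ' : Representation ℂ ↥(standardParabolicGL F (id : Fin 3 → Fin 3)) ℂ)
  (D : GL (Fin 2) F →* GL (Fin 3) F)
  (hD : ∀ g : GL (Fin 2) F, ((D g : GL (Fin 3) F) : Matrix (Fin 3) (Fin 3) F) =
    !![(g : Matrix (Fin 2) (Fin 2) F) 0 0, (g : Matrix (Fin 2) (Fin 2) F) 0 1, 0;
       (g : Matrix (Fin 2) (Fin 2) F) 1 0, (g : Matrix (Fin 2) (Fin 2) F) 1 1, 0;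
       0, 0, 1])

omit [TopologicalSpace F] [IsNonarchimedeanLocalField F] [MeasurableSpace F] [BorelSpace F] in
/-- An element of `GL₂(𝒪)` preserves the valuation balls of `F²`: `|(k v)ᵢ| ≤ ρ` whenever `|vⱼ| ≤ ρ` for all `j`. [folklore] -/
theorem valuation_mulVec_le {k : GL (Fin 2) F} (hk : k ∈ glInt 2 F) {ρ : ValueGroupWithZero F} {v : Fin 2 → F}
    (hv : ∀ i, valuation F (v i) ≤ ρ) (i : Fin 2) : valuation F (((k : Matrix (Fin 2) (Fin 2) F).mulVec v) i) ≤ ρ := by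
  have hint : ∀ i j, valuation F ((k : Matrix (Fin 2) (Fin 2) F) i j) ≤ 1 := fun i j => by
    have := ((mem_glInt_iff k).1 hk).1 i j
    rwa [Valuation.mem_integer_iff] at this
  rw [Matrix.mulVec, dotProduct, Fin.sum_univ_two]
  refine (Valuation.map_add _ _ _).trans (max_le ?_ ?_) <;> rw [map_mul]
  · exact (mul_le_mul' (hint i 0) (hv 0)).trans_eq (one_mul ρ)
  · exact (mul_le_mul' (hint i 1) (hv 1)).trans_eq (one_mul ρ)

include hD in
/-- **THE KERNEL OF THE OPEN-CELL MAP.**  If `f` vanishes on `Z` and all its cell integrals `∫ f(w·n(v)·ι̂(g)) d(μ⊗μ)` vanish, then the class of `f` in the Jacquet module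
`r_{P_{(2,1)}}(Ind_B^{GL₃} σ′)` is zero. [cite: BernsteinZelevinsky1977, Thm. 5.2] [cite: BernsteinZelevinsky1976, 2.33] [cite: Casselman1995, Prop. 6.3.1] -/
theorem mk_eq_zero_of_integral_cellFn_eq_zero {f : SmoothInd (standardParabolicGL F (id : Fin 3 → Fin 3)) σ'}
    (hf : f ∈ vanishingOn (standardParabolicGL F (id : Fin 3 → Fin 3)) σ'
      {g : GL (Fin 3) F | (g : Matrix (Fin 3) (Fin 3) F) 1 0 * (g : Matrix (Fin 3) (Fin 3) F) 2 1 - (g : Matrix (Fin 3) (Fin 3) F) 1 1 * (g : Matrix (Fin 3) (Fin 3) F) 2 0 = 0})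
    (hint : ∀ g : GL (Fin 2) F, ∫ v : Fin 2 → F,
      f.toFun (permGL (Equiv.swap (1 : Fin 3) 2 * Equiv.swap 0 1) * (transvectionUnit 0 2 h02 (v 0) * transvectionUnit 1 2 h12 (v 1)) * D g) ∂(Measure.pi fun _ : Fin 2 => μ) = 0) :
    Coinvariants.mk (restrictUnipotentGL F (![0, 0, 1] : Fin 3 → Fin 2) (smoothIndRep (standardParabolicGL F (id : Fin 3 → Fin 3)) σ')) f = 0 := by
  haveI : IsTopologicalRing F := inferInstance
  haveI : T2Space F := (isLocalField F).toT2Space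
  haveI : LocallyCompactSpace F := (isLocalField F).toLocallyCompactSpace
  haveI : SecondCountableTopology F := Literature.NumberTheory.Automorphic.secondCountableTopology_localField F
  have h01 : (0 : Fin 3) ≠ 1 := by decide
  set w : GL (Fin 3) F := permGL (Equiv.swap (1 : Fin 3) 2 * Equiv.swap 0 1) with hw
  -- `σ′ = 𝟙·χ`
  obtain ⟨χσ, hχσ⟩ := exists_eq_trivial_twist σ'
  have hσval : ∀ (x : ↥(standardParabolicGL F (id : Fin 3 → Fin 3))) (z : ℂ), σ' x z = ((χσ x : ℂˣ) : ℂ) * z := fun x z => by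
    rw [hχσ, Representation.twist_apply, Representation.trivial_apply, smul_eq_mul]
  -- `ε` and the ball `L` of radius `ε⁻¹`
  obtain ⟨ε, hα, hβ⟩ := exists_transvections_fix σ' f
  set ρ : ValueGroupWithZero F := (ε : ValueGroupWithZero F)⁻¹ with hρ
  have hρ0 : ρ ≠ 0 := inv_ne_zero ε.ne_zero
  let L : AddSubgroup (Fin 2 → F) :=
    { carrier := {v | ∀ i, valuation F (v i) ≤ ρ}
      add_mem' := fun {a b} ha hb i => by
        rw [Pi.add_apply]
        exact (Valuation.map_add _ _ _).trans (max_le (ha i) (hb i))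
      zero_mem' := fun i => by rw [Pi.zero_apply, map_zero]; exact zero_le
      neg_mem' := fun {a} ha i => by rw [Pi.neg_apply, Valuation.map_neg]; exact ha i }
  have hLmem : ∀ v : Fin 2 → F, v ∈ L ↔ ∀ i, valuation F (v i) ≤ ρ := fun _ => Iff.rfl
  have hLset : (L : Set (Fin 2 → F)) = Set.pi Set.univ fun _ : Fin 2 => {x : F | valuation F x ≤ ρ} := by
    ext v; simp only [SetLike.mem_coe, hLmem, Set.mem_univ_pi, Set.mem_setOf_eq]
  have hLo : IsOpen (L : Set (Fin 2 → F)) := by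
    rw [hLset]; exact isOpen_set_pi Set.finite_univ fun _ _ => DeltaCharBorel.isOpen_setOf_valuation_le hρ0
  have hLc : IsCompact (L : Set (Fin 2 → F)) := by
    rw [hLset]; exact isCompact_univ_pi fun _ => IsNonarchimedeanLocalField.isCompact_closedBall F ρ
  -- `e_K` over `K = n(L)` as an integral over `L`
  obtain ⟨K, c, hKU, hKc, -, -, hK⟩ := exists_avgProj_eq_smul_setIntegral μ h02 h12 σ' L hLo hLc
  -- the cell functions `φ_k` and their support
  have hsupp : ∀ {k : GL (Fin 2) F}, k ∈ glInt 2 F →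
      Function.support (fun v : Fin 2 → F => f.toFun (w * (transvectionUnit 0 2 h02 (v 0) * transvectionUnit 1 2 h12 (v 1)) * D k)) ⊆
        (0 : Fin 2 → F) +ᵥ (L : Set (Fin 2 → F)) := by
    intro k hk v hv
    rw [zero_vadd, SetLike.mem_coe, hLmem]
    by_contra hcon
    simp only [not_forall, not_le] at hcon
    obtain ⟨i, hi⟩ := hcon
    refine hv ?_
    have hdet : (k : Matrix (Fin 2) (Fin 2) F).det ≠ 0 := by
      have := k.isUnit.map Matrix.detMonoidHom
      simpa [isUnit_iff_ne_zero] using this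
    have hint1 : ∀ i j, valuation F ((k : Matrix (Fin 2) (Fin 2) F) i j) ≤ 1 := fun i j => by
      have := ((mem_glInt_iff k).1 hk).1 i j
      rwa [Valuation.mem_integer_iff] at this
    refine toFun_eq_zero_of_entry_large σ' hf hα hβ _ ?_ ?_
    · rw [hw, minor_cellPoint h02 h12 D hD]; exact hdet
    · rw [hw]
      simp only [cellPoint_apply h02 h12 D hD]
      simp only [Matrix.of_apply, Matrix.cons_val', Matrix.cons_val_zero, Matrix.cons_val_one, Matrix.cons_val_two, Matrix.empty_val',
        Matrix.cons_val_fin_one, Matrix.head_cons, Matrix.tail_cons, Matrix.head_fin_const]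
      have hε : (0 : ValueGroupWithZero F) < ε := lt_of_le_of_ne zero_le ε.ne_zero.symm
      have hmax : ρ < max (valuation F (v 0)) (valuation F (v 1)) := by
        fin_cases i
        · exact lt_of_lt_of_le hi (le_max_left _ _)
        · exact lt_of_lt_of_le hi (le_max_right _ _)
      calc max (max (valuation F ((k : Matrix (Fin 2) (Fin 2) F) 0 0)) (valuation F ((k : Matrix (Fin 2) (Fin 2) F) 0 1)))
            (max (valuation F ((k : Matrix (Fin 2) (Fin 2) F) 1 0)) (valuation F ((k : Matrix (Fin 2) (Fin 2) F) 1 1)))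
          ≤ 1 := max_le (max_le (hint1 0 0) (hint1 0 1)) (max_le (hint1 1 0) (hint1 1 1))
        _ = (ε : ValueGroupWithZero F) * ρ := by rw [hρ, mul_inv_cancel₀ ε.ne_zero]
        _ < (ε : ValueGroupWithZero F) * max (valuation F (v 0)) (valuation F (v 1)) := mul_lt_mul_of_pos_left hmax hε
  -- `e_K f = 0`
  have havg : (smoothIndRep (standardParabolicGL F (id : Fin 3 → Fin 3)) σ').avgProj K f = 0 := by
    refine SmoothInd.ext (funext fun x => ?_)
    rw [hK f x]
    change c • _ = (0 : ℂ)
    rw [smul_eq_zero]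
    refine Or.inr ?_
    by_cases hmx : (x : Matrix (Fin 3) (Fin 3) F) 1 0 * (x : Matrix (Fin 3) (Fin 3) F) 2 1 - (x : Matrix (Fin 3) (Fin 3) F) 1 1 * (x : Matrix (Fin 3) (Fin 3) F) 2 0 = 0
    · -- `x ∈ Z`: the integrand vanishes on `L`
      refine setIntegral_eq_zero_of_forall_eq_zero fun v _ => hf _ ?_
      exact minor_mul_eq_zero_of_mem_parabolic_twoOne x hmx _ (unipotentRadicalGL_le F _ (uP_mem_unipotentRadicalGL h02 h12 (v 0) (v 1)))
    · -- `x = b · w n(v′) D k`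
      obtain ⟨b, v', k, hb, hk, hx⟩ := exists_borel_mul_eq_cellPoint_glInt h02 h12 D hD h01 x hmx
      -- `x · n(v) = b · (w · n(v′ + k v) · D k)`
      have hxn : ∀ v : Fin 2 → F, x * (transvectionUnit 0 2 h02 (v 0) * transvectionUnit 1 2 h12 (v 1)) =
          b * (w * (transvectionUnit 0 2 h02 ((v' + (k : Matrix (Fin 2) (Fin 2) F).mulVec v) 0) *
            transvectionUnit 1 2 h12 ((v' + (k : Matrix (Fin 2) (Fin 2) F).mulVec v) 1)) * D k) := by
        intro v
        have hc := uP_mul_diag h02 h12 D hD ((k : Matrix (Fin 2) (Fin 2) F).mulVec v) k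
        rw [Matrix.mulVec_mulVec, ← Units.val_mul, inv_mul_cancel, Units.val_one, Matrix.one_mulVec] at hc
        have hc' : transvectionUnit 0 2 h02 (((k : Matrix (Fin 2) (Fin 2) F).mulVec v) 0) *
            (transvectionUnit 1 2 h12 (((k : Matrix (Fin 2) (Fin 2) F).mulVec v) 1) * D k) =
            D k * (transvectionUnit 0 2 h02 (v 0) * transvectionUnit 1 2 h12 (v 1)) := by rw [← mul_assoc]; exact hc
        rw [hw, hx, Pi.add_apply, Pi.add_apply, uP_add h02 h12]
        simp only [mul_assoc, hc']
      have hfx : ∀ v : Fin 2 → F, f.toFun (x * (transvectionUnit 0 2 h02 (v 0) * transvectionUnit 1 2 h12 (v 1))) =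
          ((χσ ⟨b, hb⟩ : ℂˣ) : ℂ) * f.toFun (w * (transvectionUnit 0 2 h02 ((v' + (k : Matrix (Fin 2) (Fin 2) F).mulVec v) 0) *
            transvectionUnit 1 2 h12 ((v' + (k : Matrix (Fin 2) (Fin 2) F).mulVec v) 1)) * D k) := by
        intro v
        rw [hxn, ← hσval]
        exact f.toFun_subgroup_mul ⟨b, hb⟩ _
      simp_rw [hfx]
      rw [integral_const_mul, mul_eq_zero]
      refine Or.inr ?_
      -- substitution `u = k v` on `L` (`k L = L`), then translation by `v′`, then (τ1)
      let e : (Fin 2 → F) ≃ₗ[F] (Fin 2 → F) :=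
        { toLinearMap := Matrix.toLin' ((k : GL (Fin 2) F) : Matrix (Fin 2) (Fin 2) F)
          invFun := Matrix.toLin' ((k⁻¹ : GL (Fin 2) F) : Matrix (Fin 2) (Fin 2) F)
          left_inv := fun v => by
            simp only [LinearMap.toFun_eq_coe, Matrix.toLin'_apply, Matrix.mulVec_mulVec, ← Units.val_mul, inv_mul_cancel, Units.val_one, Matrix.one_mulVec]
          right_inv := fun v => by
            simp only [LinearMap.toFun_eq_coe, Matrix.toLin'_apply, Matrix.mulVec_mulVec, ← Units.val_mul, mul_inv_cancel, Units.val_one, Matrix.one_mulVec] }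
      have he : ∀ v, e v = (k : Matrix (Fin 2) (Fin 2) F).mulVec v := fun v => Matrix.toLin'_apply _ _
      have heL : (fun a : Fin 2 → F => (k : Matrix (Fin 2) (Fin 2) F).mulVec a) '' (L : Set (Fin 2 → F)) = (L : Set (Fin 2 → F)) := by
        apply Set.Subset.antisymm
        · rintro _ ⟨v, hv, rfl⟩
          rw [SetLike.mem_coe, hLmem] at hv ⊢
          intro i; exact valuation_mulVec_le hk hv i
        · intro u hu
          refine ⟨((k⁻¹ : GL (Fin 2) F) : Matrix (Fin 2) (Fin 2) F).mulVec u, ?_, ?_⟩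
          · rw [SetLike.mem_coe, hLmem] at hu ⊢
            intro i; exact valuation_mulVec_le (Subgroup.inv_mem _ hk) hu i
          · change (k : Matrix (Fin 2) (Fin 2) F).mulVec ((((k⁻¹ : GL (Fin 2) F) : Matrix (Fin 2) (Fin 2) F)).mulVec u) = u
            rw [Matrix.mulVec_mulVec, ← Units.val_mul, mul_inv_cancel, Units.val_one, Matrix.one_mulVec]
      have hsub := setIntegral_comp_linearEquiv μ e (fun u : Fin 2 → F =>
        f.toFun (w * (transvectionUnit 0 2 h02 ((v' + u) 0) * transvectionUnit 1 2 h12 ((v' + u) 1)) * D k)) (L : Set (Fin 2 → F))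
      simp only [he] at hsub
      rw [hsub, heL, smul_eq_zero]
      refine Or.inr ?_
      -- translation by `v′`
      haveI : SigmaFinite μ := by infer_instance
      have htr := (measurePreserving_add_left (Measure.pi fun _ : Fin 2 => μ) v').setIntegral_image_emb (MeasurableEquiv.addLeft v').measurableEmbedding
        (fun u : Fin 2 → F => f.toFun (w * (transvectionUnit 0 2 h02 (u 0) * transvectionUnit 1 2 h12 (u 1)) * D k)) (L : Set (Fin 2 → F))
      have himg : (fun u : Fin 2 → F => v' + u) '' (L : Set (Fin 2 → F)) = v' +ᵥ (L : Set (Fin 2 → F)) := by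
        rw [← Set.image_vadd]; rfl
      rw [← htr, himg]
      exact setIntegral_leftAddCoset_eq_zero_of_support_subset (Measure.pi fun _ : Fin 2 => μ) L (hsupp hk) (hint k) v'

  -- `[f] = [e_K f] = 0`
  have hv : (smoothIndRep (standardParabolicGL F (id : Fin 3 → Fin 3)) σ').IsSmoothVector f := isSmooth_smoothInd _ _ f
  rw [← mk_restrictUnipotentGL_avgProj (![0, 0, 1] : Fin 3 → Fin 2) (smoothIndRep (standardParabolicGL F (id : Fin 3 → Fin 3)) σ') hKc hKU hv, havg, map_zero]

end Summit.HodgeConjecture.HodgeConjecture.Cruxes.H413.K2E3GL3BorelInducedJacquetQOpenCellKernel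

end
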